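import Literature.Barriers.AtomisticToContinuum.HcpNotBravais
import HarnessLib

/-!
# Co-axiality criteria for a pair of moved fcc lattices (crux `GenericWallFloor`, line `WallLedgerG`)

HONEST FRAMING. Part of the venture `Summits/Ventures/Crystal3D` (cell `crystal3d-full`), helper
`--supports` the crux `GenericWallFloor` (stmt-Ventures-19480) of `route-Ventures-StickyWulffConstant`,
registered line `WallLedgerG` (planner cf-p1 gen 16), stub `stub_twoSlabAdhesion : TwoSlabAdhesion`.

The crux and the stub charge the wall floor `c₀ = 1` only to NON-CO-AXIAL pairs of moved fcc
lattices `Λ₁ = A₁·Λ₀ + t₁`, `Λ₂ = A₂·Λ₀ + t₂` (`Λ₀ = fccStacking 1 √(2/3)`), where CO-AXIAL is the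
literal `∃`-clause

  `∃ L s₁ s₂ σ σ', IsHaggSeq σ ∧ IsHaggSeq σ' ∧ A₁·Λ₀ + t₁ ⊆ L·B(σ) + s₁ ∧ A₂·Λ₀ + t₂ ⊆ L·B(σ') + s₂`

(`B(σ) = barlowStacking 1 √(2/3) σ`).  Every rigidity proof of the stub ends by CONSTRUCTING such a
frame from a defect-poor filling and contradicting non-co-axiality.  This file supplies that endgame in
the kernel, as SUFFICIENT conditions for the clause:

* `coaxial_of_subset_frame` — a common LINEAR frame `L` with `Aᵢ·Λ₀ ⊆ L·B(σᵢ)` (any Hägg `σᵢ`)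
  gives the clause (translations are free: `sᵢ = tᵢ`);
* `coaxial_of_image_eq` — equal linear lattices `A₁·Λ₀ = A₂·Λ₀` (same orientation, ANY two
  translations) are co-axial; `coaxial_self`;
* `coaxial_of_image_eq_twin` / `coaxial_of_twin_image_eq` — if `A₂·Λ₀` is the `e₃`-MIRROR TWIN
  `A₁·Λ₀⁻`, `Λ₀⁻ = barlowStacking 1 √(2/3) (−1)` (the stacking `…ACBACB…`), the pair is co-axial;
* `coaxial_of_common_frame` — the form produced by shell capture: one `L` with
  `Aᵢ·Λ₀ ∈ {L·Λ₀, L·Λ₀⁻}` for `i = 1, 2`;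
* contrapositives `image_ne_of_not_coaxial` (a non-co-axial pair has different linear lattices and
  is not an `e₃`-twin pair in either order, in every common frame);
* bookkeeping for the twin stacking: `isHaggSeq_negConst`, `haggLabel_negConst`,
  `mem_barlowStacking_negConst_iff` (its points are the points of `Λ₀` with `x₂` negated).

WHAT THIS IS NOT: the converse (co-axial ⇒ same orientation or a Σ3 twin about a shared ⟨111⟩ axis)
is not proved here and is not needed by the stub; nothing about walls; rung F-C1 not moved.
-/

noncomputable section

namespace Summit.Ventures.Crystal3D.Theorems

open Literature.MathematicalPhysics.StatisticalMechanics
open Literature.Barriers.AtomisticToContinuum (haggLabel_eq_mul_of_const barlowAddSubgroupOfConst)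

/-! ### The mirror (twin) stacking `B(−1)` -/

/-- The mirror Hägg sequence `k ↦ −1` (stacking `…ACBACB…`) is a Hägg sequence. -/
theorem isHaggSeq_negConst : IsHaggSeq (fun _ : ℤ => (-1 : ℤ)) := fun _ => Or.inr rfl

/-- Labels of the mirror sequence: `L m = −m`. -/
theorem haggLabel_negConst (m : ℤ) : haggLabel (fun _ : ℤ => (-1 : ℤ)) m = -m := by
  rw [haggLabel_eq_mul_of_const (s := fun _ : ℤ => (-1 : ℤ)) (fun _ => rfl)]
  ring

/-- Coordinates of the twin stacking: the site `(k, i, j)` of `B(−1)` is the site `(−k, i, j)` of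
`Λ₀ = B(+1)` with the third coordinate negated. -/
theorem barlowPos_negConst_apply (H : ℝ) (k i j : ℤ) :
    barlowPos 1 H (fun _ : ℤ => (-1 : ℤ)) k i j 0 = barlowPos 1 H constHagg (-k) i j 0 ∧
    barlowPos 1 H (fun _ : ℤ => (-1 : ℤ)) k i j 1 = barlowPos 1 H constHagg (-k) i j 1 ∧
    barlowPos 1 H (fun _ : ℤ => (-1 : ℤ)) k i j 2 = -barlowPos 1 H constHagg (-k) i j 2 := by
  refine ⟨?_, ?_, ?_⟩
  · simp only [barlowPos_apply_zero, haggLabel_negConst, haggLabel_const]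
  · simp only [barlowPos_apply_one, haggLabel_negConst, haggLabel_const]
  · simp only [barlowPos_apply_two]
    push_cast
    ring

/-- **The twin stacking is the `e₃`-mirror image of `Λ₀`:** `p ∈ B(−1)` iff the point
`(p₀, p₁, −p₂)` lies in `Λ₀ = fccStacking 1 H`. -/
theorem mem_barlowStacking_negConst_iff (H : ℝ) (p : EuclideanSpace ℝ (Fin 3)) :
    p ∈ barlowStacking 1 H (fun _ : ℤ => (-1 : ℤ)) ↔ !₂[p 0, p 1, -p 2] ∈ fccStacking 1 H := by
  constructor
  · rintro ⟨k, i, j, rfl⟩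
    obtain ⟨h0, h1, h2⟩ := barlowPos_negConst_apply H k i j
    refine ⟨-k, i, j, ?_⟩
    ext l
    fin_cases l
    · simpa using h0
    · simpa using h1
    · simp [h2]
  · rintro ⟨k, i, j, hk⟩
    refine ⟨-k, i, j, ?_⟩
    obtain ⟨h0, h1, h2⟩ := barlowPos_negConst_apply H (-k) i j
    rw [neg_neg] at h0 h1 h2
    have e0 := congrArg (fun q : EuclideanSpace ℝ (Fin 3) => q 0) hk
    have e1 := congrArg (fun q : EuclideanSpace ℝ (Fin 3) => q 1) hk
    have e2 := congrArg (fun q : EuclideanSpace ℝ (Fin 3) => q 2) hk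
    simp only at e0 e1 e2
    ext l
    fin_cases l
    · simp at e0; simp [h0, ← e0]
    · simp at e1; simp [h1, ← e1]
    · simp at e2; simp [h2]; linarith

/-! ### Sufficient conditions for co-axiality -/

/-- **Co-axiality from a common linear frame.**  If ONE linear isometry `L` carries Barlow
stackings `B(σ₁)`, `B(σ₂)` (any Hägg words) onto supersets of the linear lattices `A₁·Λ₀`,
`A₂·Λ₀`, then the moved lattices `A₁·Λ₀ + t₁`, `A₂·Λ₀ + t₂` are co-axial for EVERY pair of
translations — the literal `∃`-clause of `GenericWallFloor` / `TwoSlabAdhesion` / `CoaxialWallLaw`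
(with `sᵢ = tᵢ`). -/
theorem coaxial_of_subset_frame
    (A₁ A₂ L : EuclideanSpace ℝ (Fin 3) ≃ₗᵢ[ℝ] EuclideanSpace ℝ (Fin 3))
    (t₁ t₂ : EuclideanSpace ℝ (Fin 3)) (σ₁ σ₂ : ℤ → ℤ) (hσ₁ : IsHaggSeq σ₁) (hσ₂ : IsHaggSeq σ₂)
    (h₁ : A₁ '' fccStacking 1 (Real.sqrt (2 / 3)) ⊆ L '' barlowStacking 1 (Real.sqrt (2 / 3)) σ₁)
    (h₂ : A₂ '' fccStacking 1 (Real.sqrt (2 / 3)) ⊆ L '' barlowStacking 1 (Real.sqrt (2 / 3)) σ₂) :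
    ∃ (L' : EuclideanSpace ℝ (Fin 3) ≃ₗᵢ[ℝ] EuclideanSpace ℝ (Fin 3))
      (s₁ s₂ : EuclideanSpace ℝ (Fin 3)) (σ σ' : ℤ → ℤ), IsHaggSeq σ ∧ IsHaggSeq σ' ∧
      (fun p => A₁ p + t₁) '' fccStacking 1 (Real.sqrt (2 / 3)) ⊆
        (fun p => L' p + s₁) '' barlowStacking 1 (Real.sqrt (2 / 3)) σ ∧
      (fun p => A₂ p + t₂) '' fccStacking 1 (Real.sqrt (2 / 3)) ⊆
        (fun p => L' p + s₂) '' barlowStacking 1 (Real.sqrt (2 / 3)) σ' := by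
  refine ⟨L, t₁, t₂, σ₁, σ₂, hσ₁, hσ₂, ?_, ?_⟩
  · rintro _ ⟨p, hp, rfl⟩
    obtain ⟨q, hq, hq'⟩ := h₁ ⟨p, hp, rfl⟩
    exact ⟨q, hq, by simp only [hq']⟩
  · rintro _ ⟨p, hp, rfl⟩
    obtain ⟨q, hq, hq'⟩ := h₂ ⟨p, hp, rfl⟩
    exact ⟨q, hq, by simp only [hq']⟩

/-- **Common frame, shell-capture form.**  One linear isometry `L` with
`Aᵢ·Λ₀ ∈ {L·Λ₀, L·Λ₀⁻}` for both `i` (`Λ₀⁻ = B(−1)` the `e₃`-mirror twin) ⇒ co-axial. -/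
theorem coaxial_of_common_frame
    (A₁ A₂ L : EuclideanSpace ℝ (Fin 3) ≃ₗᵢ[ℝ] EuclideanSpace ℝ (Fin 3))
    (t₁ t₂ : EuclideanSpace ℝ (Fin 3))
    (h₁ : A₁ '' fccStacking 1 (Real.sqrt (2 / 3)) = L '' fccStacking 1 (Real.sqrt (2 / 3)) ∨
      A₁ '' fccStacking 1 (Real.sqrt (2 / 3)) =
        L '' barlowStacking 1 (Real.sqrt (2 / 3)) (fun _ : ℤ => (-1 : ℤ)))
    (h₂ : A₂ '' fccStacking 1 (Real.sqrt (2 / 3)) = L '' fccStacking 1 (Real.sqrt (2 / 3)) ∨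
      A₂ '' fccStacking 1 (Real.sqrt (2 / 3)) =
        L '' barlowStacking 1 (Real.sqrt (2 / 3)) (fun _ : ℤ => (-1 : ℤ))) :
    ∃ (L' : EuclideanSpace ℝ (Fin 3) ≃ₗᵢ[ℝ] EuclideanSpace ℝ (Fin 3))
      (s₁ s₂ : EuclideanSpace ℝ (Fin 3)) (σ σ' : ℤ → ℤ), IsHaggSeq σ ∧ IsHaggSeq σ' ∧
      (fun p => A₁ p + t₁) '' fccStacking 1 (Real.sqrt (2 / 3)) ⊆
        (fun p => L' p + s₁) '' barlowStacking 1 (Real.sqrt (2 / 3)) σ ∧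
      (fun p => A₂ p + t₂) '' fccStacking 1 (Real.sqrt (2 / 3)) ⊆
        (fun p => L' p + s₂) '' barlowStacking 1 (Real.sqrt (2 / 3)) σ' := by
  rcases h₁ with h₁ | h₁ <;> rcases h₂ with h₂ | h₂
  · exact coaxial_of_subset_frame A₁ A₂ L t₁ t₂ constHagg constHagg isHaggSeq_const isHaggSeq_const
      h₁.subset h₂.subset
  · exact coaxial_of_subset_frame A₁ A₂ L t₁ t₂ constHagg _ isHaggSeq_const isHaggSeq_negConst
      h₁.subset h₂.subset
  · exact coaxial_of_subset_frame A₁ A₂ L t₁ t₂ _ constHagg isHaggSeq_negConst isHaggSeq_const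
      h₁.subset h₂.subset
  · exact coaxial_of_subset_frame A₁ A₂ L t₁ t₂ _ _ isHaggSeq_negConst isHaggSeq_negConst
      h₁.subset h₂.subset

/-- **Same orientation ⇒ co-axial**: equal linear lattices `A₁·Λ₀ = A₂·Λ₀` are co-axial for ANY
two translations `t₁, t₂` (frame `L = A₁`, both words the fcc word `…ABC…`). -/
theorem coaxial_of_image_eq
    (A₁ A₂ : EuclideanSpace ℝ (Fin 3) ≃ₗᵢ[ℝ] EuclideanSpace ℝ (Fin 3))
    (t₁ t₂ : EuclideanSpace ℝ (Fin 3))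
    (h : A₁ '' fccStacking 1 (Real.sqrt (2 / 3)) = A₂ '' fccStacking 1 (Real.sqrt (2 / 3))) :
    ∃ (L' : EuclideanSpace ℝ (Fin 3) ≃ₗᵢ[ℝ] EuclideanSpace ℝ (Fin 3))
      (s₁ s₂ : EuclideanSpace ℝ (Fin 3)) (σ σ' : ℤ → ℤ), IsHaggSeq σ ∧ IsHaggSeq σ' ∧
      (fun p => A₁ p + t₁) '' fccStacking 1 (Real.sqrt (2 / 3)) ⊆
        (fun p => L' p + s₁) '' barlowStacking 1 (Real.sqrt (2 / 3)) σ ∧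
      (fun p => A₂ p + t₂) '' fccStacking 1 (Real.sqrt (2 / 3)) ⊆
        (fun p => L' p + s₂) '' barlowStacking 1 (Real.sqrt (2 / 3)) σ' :=
  coaxial_of_common_frame A₁ A₂ A₁ t₁ t₂ (Or.inl rfl) (Or.inl h.symm)

/-- **One lattice, two translations ⇒ co-axial** (the translation subgroup of a grain never
produces a wall charged by `GenericWallFloor`). -/
theorem coaxial_self (A : EuclideanSpace ℝ (Fin 3) ≃ₗᵢ[ℝ] EuclideanSpace ℝ (Fin 3))
    (t₁ t₂ : EuclideanSpace ℝ (Fin 3)) :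
    ∃ (L' : EuclideanSpace ℝ (Fin 3) ≃ₗᵢ[ℝ] EuclideanSpace ℝ (Fin 3))
      (s₁ s₂ : EuclideanSpace ℝ (Fin 3)) (σ σ' : ℤ → ℤ), IsHaggSeq σ ∧ IsHaggSeq σ' ∧
      (fun p => A p + t₁) '' fccStacking 1 (Real.sqrt (2 / 3)) ⊆
        (fun p => L' p + s₁) '' barlowStacking 1 (Real.sqrt (2 / 3)) σ ∧
      (fun p => A p + t₂) '' fccStacking 1 (Real.sqrt (2 / 3)) ⊆
        (fun p => L' p + s₂) '' barlowStacking 1 (Real.sqrt (2 / 3)) σ' :=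
  coaxial_of_image_eq A A t₁ t₂ rfl

/-- **Mirror twin ⇒ co-axial**: if the second linear lattice is the `e₃`-mirror twin of the first
in the first's own frame, `A₂·Λ₀ = A₁·Λ₀⁻` (`Λ₀⁻ = B(−1)`: coherent Σ3 twin about the shared
close-packed axis `A₁e₃`), the pair is co-axial (frame `L = A₁`, words `…ABC…` and `…ACB…`). -/
theorem coaxial_of_image_eq_twin
    (A₁ A₂ : EuclideanSpace ℝ (Fin 3) ≃ₗᵢ[ℝ] EuclideanSpace ℝ (Fin 3))
    (t₁ t₂ : EuclideanSpace ℝ (Fin 3))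
    (h : A₂ '' fccStacking 1 (Real.sqrt (2 / 3)) =
      A₁ '' barlowStacking 1 (Real.sqrt (2 / 3)) (fun _ : ℤ => (-1 : ℤ))) :
    ∃ (L' : EuclideanSpace ℝ (Fin 3) ≃ₗᵢ[ℝ] EuclideanSpace ℝ (Fin 3))
      (s₁ s₂ : EuclideanSpace ℝ (Fin 3)) (σ σ' : ℤ → ℤ), IsHaggSeq σ ∧ IsHaggSeq σ' ∧
      (fun p => A₁ p + t₁) '' fccStacking 1 (Real.sqrt (2 / 3)) ⊆
        (fun p => L' p + s₁) '' barlowStacking 1 (Real.sqrt (2 / 3)) σ ∧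
      (fun p => A₂ p + t₂) '' fccStacking 1 (Real.sqrt (2 / 3)) ⊆
        (fun p => L' p + s₂) '' barlowStacking 1 (Real.sqrt (2 / 3)) σ' :=
  coaxial_of_common_frame A₁ A₂ A₁ t₁ t₂ (Or.inl rfl) (Or.inr h)

/-- **Mirror twin ⇒ co-axial**, the other order: `A₁·Λ₀ = A₂·Λ₀⁻`. -/
theorem coaxial_of_twin_image_eq
    (A₁ A₂ : EuclideanSpace ℝ (Fin 3) ≃ₗᵢ[ℝ] EuclideanSpace ℝ (Fin 3))
    (t₁ t₂ : EuclideanSpace ℝ (Fin 3))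
    (h : A₁ '' fccStacking 1 (Real.sqrt (2 / 3)) =
      A₂ '' barlowStacking 1 (Real.sqrt (2 / 3)) (fun _ : ℤ => (-1 : ℤ))) :
    ∃ (L' : EuclideanSpace ℝ (Fin 3) ≃ₗᵢ[ℝ] EuclideanSpace ℝ (Fin 3))
      (s₁ s₂ : EuclideanSpace ℝ (Fin 3)) (σ σ' : ℤ → ℤ), IsHaggSeq σ ∧ IsHaggSeq σ' ∧
      (fun p => A₁ p + t₁) '' fccStacking 1 (Real.sqrt (2 / 3)) ⊆
        (fun p => L' p + s₁) '' barlowStacking 1 (Real.sqrt (2 / 3)) σ ∧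
      (fun p => A₂ p + t₂) '' fccStacking 1 (Real.sqrt (2 / 3)) ⊆
        (fun p => L' p + s₂) '' barlowStacking 1 (Real.sqrt (2 / 3)) σ' :=
  coaxial_of_common_frame A₁ A₂ A₂ t₁ t₂ (Or.inr h) (Or.inl rfl)

/-- **What non-co-axiality gives a proof by contradiction** (contrapositive package): for a
NON-co-axial pair, in EVERY linear frame `L` at least one of the two linear lattices is neither
`L·Λ₀` nor its mirror twin `L·Λ₀⁻`; in particular the linear lattices differ and neither is the
other's `e₃`-twin. -/
theorem image_ne_of_not_coaxial
    (A₁ A₂ : EuclideanSpace ℝ (Fin 3) ≃ₗᵢ[ℝ] EuclideanSpace ℝ (Fin 3))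
    (t₁ t₂ : EuclideanSpace ℝ (Fin 3))
    (h : ¬ ∃ (L' : EuclideanSpace ℝ (Fin 3) ≃ₗᵢ[ℝ] EuclideanSpace ℝ (Fin 3))
      (s₁ s₂ : EuclideanSpace ℝ (Fin 3)) (σ σ' : ℤ → ℤ), IsHaggSeq σ ∧ IsHaggSeq σ' ∧
      (fun p => A₁ p + t₁) '' fccStacking 1 (Real.sqrt (2 / 3)) ⊆
        (fun p => L' p + s₁) '' barlowStacking 1 (Real.sqrt (2 / 3)) σ ∧
      (fun p => A₂ p + t₂) '' fccStacking 1 (Real.sqrt (2 / 3)) ⊆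
        (fun p => L' p + s₂) '' barlowStacking 1 (Real.sqrt (2 / 3)) σ') :
    A₁ '' fccStacking 1 (Real.sqrt (2 / 3)) ≠ A₂ '' fccStacking 1 (Real.sqrt (2 / 3)) ∧
    A₂ '' fccStacking 1 (Real.sqrt (2 / 3)) ≠
      A₁ '' barlowStacking 1 (Real.sqrt (2 / 3)) (fun _ : ℤ => (-1 : ℤ)) ∧
    A₁ '' fccStacking 1 (Real.sqrt (2 / 3)) ≠
      A₂ '' barlowStacking 1 (Real.sqrt (2 / 3)) (fun _ : ℤ => (-1 : ℤ)) ∧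
    ∀ L : EuclideanSpace ℝ (Fin 3) ≃ₗᵢ[ℝ] EuclideanSpace ℝ (Fin 3),
      ¬ ((A₁ '' fccStacking 1 (Real.sqrt (2 / 3)) = L '' fccStacking 1 (Real.sqrt (2 / 3)) ∨
          A₁ '' fccStacking 1 (Real.sqrt (2 / 3)) =
            L '' barlowStacking 1 (Real.sqrt (2 / 3)) (fun _ : ℤ => (-1 : ℤ))) ∧
        (A₂ '' fccStacking 1 (Real.sqrt (2 / 3)) = L '' fccStacking 1 (Real.sqrt (2 / 3)) ∨
          A₂ '' fccStacking 1 (Real.sqrt (2 / 3)) =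
            L '' barlowStacking 1 (Real.sqrt (2 / 3)) (fun _ : ℤ => (-1 : ℤ)))) :=
  ⟨fun e => h (coaxial_of_image_eq A₁ A₂ t₁ t₂ e),
    fun e => h (coaxial_of_image_eq_twin A₁ A₂ t₁ t₂ e),
    fun e => h (coaxial_of_twin_image_eq A₁ A₂ t₁ t₂ e),
    fun L hL => h (coaxial_of_common_frame A₁ A₂ L t₁ t₂ hL.1 hL.2)⟩

end Summit.Ventures.Crystal3D.Theorems

end
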